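import Summits.ResolutionOfSingularities.ResolutionOfSingularities.Theorems.WeightedInvariantPClassFrobenius

/-!
# (F-3) File D — class components of a series with a single initial monomial  [OURS · L1 W4.3]

Kernel infrastructure for RE-ENTRY OBJECT #1 of chain w43 (the DOM word at level ≤ 3,
door crux `stmt-ResolutionOfSingularities-19897`), continuing files A–C
(`WeightedInvariantPClassDecomposition`, `…PClassMonomialIdeals`, `…PClassFrobenius`).

This file isolates the bookkeeping step «two classes cannot merge into one monomial» of the
Frobenius-class argument (O70B-JCAN-PLAN §7, cases (α)/(β)): if the weighted initial form of `v` is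
a SINGLE MONOMIAL `c·X^m` (i.e. `m` is the unique exponent of minimal weight in the support of `v`),
then

* the class component of the class of `m` has the same weighted order `weight m` and the same
  initial monomial, and removing it raises the weighted order
  (`weightedOrder_pClassComponent_of_initialMonomial`,
  `weight_lt_weightedOrder_sub_pClassComponent_of_initialMonomial`);
* every other class component has weighted order `> weight m`, and removing it changes nothing at
  weight `weight m` (`weight_lt_weightedOrder_pClassComponent_of_initialMonomial`,
  `weightedOrder_sub_pClassComponent_of_initialMonomial`);
* the (α)/(β) DICHOTOMY for `G := v_0`, `R := v - v_0` (`initialMonomial_dichotomy`).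

Also: the complementary parts `f - f_κ` (`coeff_sub_pClassComponent_of_eq/_of_ne`,
`pClassComponent_sub_pClassComponent_self/_of_ne`, `le_weightedOrder_sub_pClassComponent`) and
LEFT-PURE MULTIPLICATIVITY `(G·g)_κ = G·g_{κ-κ₀}` for `G` pure of class `κ₀`
(`pClassComponent_mul_of_left_pure`, `…_of_left_pure_zero`, right versions).

[OURS · L1 W4.3] replaces the role of the initial-form bookkeeping of the Frobenius-class argument;
NOT a statement of the manuscript.
-/

set_option linter.dupNamespace false

namespace Summit.ResolutionOfSingularities.ResolutionOfSingularities.Theorems.LocalEngine.Iota3.PClass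

open MvPowerSeries

variable {σ : Type*} {K : Type*} [CommRing K]

/-! ## The complementary part `f - f_κ` -/

/-- `f - f_κ` has no exponent of class `κ`. -/
theorem coeff_sub_pClassComponent_of_eq {p : ℕ} {κ : σ → ZMod p} {e : σ →₀ ℕ}
    (h : exponentClass p e = κ) (f : MvPowerSeries σ K) :
    coeff e (f - pClassComponent p κ f) = 0 := by
  rw [map_sub, coeff_pClassComponent_of_eq h, sub_self]

/-- Away from class `κ`, `f - f_κ` has the coefficients of `f`. -/
theorem coeff_sub_pClassComponent_of_ne {p : ℕ} {κ : σ → ZMod p} {e : σ →₀ ℕ}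
    (h : exponentClass p e ≠ κ) (f : MvPowerSeries σ K) :
    coeff e (f - pClassComponent p κ f) = coeff e f := by
  rw [map_sub, coeff_pClassComponent_of_ne h, sub_zero]

/-- `(f - f_κ)_κ = 0`. -/
theorem pClassComponent_sub_pClassComponent_self (p : ℕ) (κ : σ → ZMod p) (f : MvPowerSeries σ K) :
    pClassComponent p κ (f - pClassComponent p κ f) = 0 :=
  pClassComponent_eq_zero fun _ he => coeff_sub_pClassComponent_of_eq he f

/-- `(f - f_κ)_{κ'} = f_{κ'}` for `κ' ≠ κ`. -/
theorem pClassComponent_sub_pClassComponent_of_ne (p : ℕ) {κ κ' : σ → ZMod p} (h : κ' ≠ κ)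
    (f : MvPowerSeries σ K) :
    pClassComponent p κ' (f - pClassComponent p κ f) = pClassComponent p κ' f := by
  ext e
  rw [coeff_pClassComponent, coeff_pClassComponent]
  split_ifs with he
  · exact coeff_sub_pClassComponent_of_ne (fun h' => h (he.symm.trans h')) f
  · rfl

/-- Removing a class component does not lower the weighted order. -/
theorem le_weightedOrder_sub_pClassComponent (w : σ → ℕ) (p : ℕ) (κ : σ → ZMod p)
    (f : MvPowerSeries σ K) : f.weightedOrder w ≤ (f - pClassComponent p κ f).weightedOrder w := by
  refine le_weightedOrder w fun d hd => ?_
  by_cases hcl : exponentClass p d = κ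
  · exact coeff_sub_pClassComponent_of_eq hcl f
  · rw [coeff_sub_pClassComponent_of_ne hcl]
    exact coeff_eq_zero_of_lt_weightedOrder w hd

/-! ## Left-pure multiplicativity -/

/-- LEFT-PURE MULTIPLICATIVITY: for `G` pure of class `κ₀`, `(G·g)_κ = G·g_{κ-κ₀}`. -/
theorem pClassComponent_mul_of_left_pure [Fintype σ] [DecidableEq σ] {p : ℕ} [NeZero p]
    {κ₀ : σ → ZMod p} {G : MvPowerSeries σ K} (hG : pClassComponent p κ₀ G = G) (κ : σ → ZMod p)
    (g : MvPowerSeries σ K) : pClassComponent p κ (G * g) = G * pClassComponent p (κ - κ₀) g := by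
  rw [pClassComponent_mul,
    Finset.sum_eq_single κ₀ (fun κ₁ _ hne => by
      rw [← hG, pClassComponent_pClassComponent, if_neg hne, zero_mul])
      (fun h => absurd (Finset.mem_univ _) h), hG]

/-- For `G` pure of class `0`: `(G·g)_κ = G·g_κ`. -/
theorem pClassComponent_mul_of_left_pure_zero [Fintype σ] [DecidableEq σ] {p : ℕ} [NeZero p]
    {G : MvPowerSeries σ K} (hG : pClassComponent p 0 G = G) (κ : σ → ZMod p)
    (g : MvPowerSeries σ K) : pClassComponent p κ (G * g) = G * pClassComponent p κ g := by
  rw [pClassComponent_mul_of_left_pure hG, sub_zero]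

/-- RIGHT-PURE MULTIPLICATIVITY: for `G` pure of class `κ₀`, `(g·G)_κ = g_{κ-κ₀}·G`. -/
theorem pClassComponent_mul_of_right_pure [Fintype σ] [DecidableEq σ] {p : ℕ} [NeZero p]
    {κ₀ : σ → ZMod p} {G : MvPowerSeries σ K} (hG : pClassComponent p κ₀ G = G) (κ : σ → ZMod p)
    (g : MvPowerSeries σ K) : pClassComponent p κ (g * G) = pClassComponent p (κ - κ₀) g * G := by
  rw [mul_comm, pClassComponent_mul_of_left_pure hG, mul_comm]

/-- For `G` pure of class `0`: `(g·G)_κ = g_κ·G`. -/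
theorem pClassComponent_mul_of_right_pure_zero [Fintype σ] [DecidableEq σ] {p : ℕ} [NeZero p]
    {G : MvPowerSeries σ K} (hG : pClassComponent p 0 G = G) (κ : σ → ZMod p)
    (g : MvPowerSeries σ K) : pClassComponent p κ (g * G) = pClassComponent p κ g * G := by
  rw [pClassComponent_mul_of_right_pure hG, sub_zero]

/-! ## Series with a single initial monomial

`m` is the unique exponent of minimal `w`-weight in the support of `v`:
`coeff m v ≠ 0` and every other exponent of the support has strictly larger weight. -/

section InitialMonomial

variable (w : σ → ℕ) {v : MvPowerSeries σ K} {m : σ →₀ ℕ}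

/-- The weighted order of a series with single initial monomial `X^m` is `weight m`. -/
theorem weightedOrder_eq_of_initialMonomial (hcm : coeff m v ≠ 0)
    (hini : ∀ d, coeff d v ≠ 0 → d ≠ m → Finsupp.weight w m < Finsupp.weight w d) :
    v.weightedOrder w = Finsupp.weight w m := by
  refine (weightedOrder_eq_nat w).mpr ⟨⟨m, hcm, rfl⟩, fun d hd => ?_⟩
  by_contra h
  by_cases hdm : d = m
  · subst hdm
    exact lt_irrefl _ hd
  · exact lt_asymm hd (hini d h hdm)

/-- At weight `≤ weight m` the only exponent of the support is `m`. -/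
theorem coeff_eq_zero_of_initialMonomial (hini : ∀ d, coeff d v ≠ 0 → d ≠ m →
      Finsupp.weight w m < Finsupp.weight w d) {d : σ →₀ ℕ}
    (hd : Finsupp.weight w d ≤ Finsupp.weight w m) (hdm : d ≠ m) : coeff d v = 0 := by
  by_contra h
  exact absurd (hini d h hdm) (not_lt.mpr hd)

/-- The class component of the initial class keeps the initial coefficient. -/
theorem coeff_pClassComponent_initialMonomial (p : ℕ) (v : MvPowerSeries σ K) (m : σ →₀ ℕ) :
    coeff m (pClassComponent p (exponentClass p m) v) = coeff m v :=
  coeff_pClassComponent_of_eq rfl v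

/-- The class component of the initial class again has single initial monomial `X^m`. -/
theorem initialMonomial_pClassComponent (p : ℕ)
    (hini : ∀ d, coeff d v ≠ 0 → d ≠ m → Finsupp.weight w m < Finsupp.weight w d) (d : σ →₀ ℕ)
    (hd : coeff d (pClassComponent p (exponentClass p m) v) ≠ 0) (hdm : d ≠ m) :
    Finsupp.weight w m < Finsupp.weight w d := by
  refine hini d (fun h => hd ?_) hdm
  rw [coeff_pClassComponent]
  split_ifs
  · exact h
  · rfl

/-- The class component of the INITIAL class has weighted order `weight m = W(v)`. -/
theorem weightedOrder_pClassComponent_of_initialMonomial (p : ℕ) (hcm : coeff m v ≠ 0)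
    (hini : ∀ d, coeff d v ≠ 0 → d ≠ m → Finsupp.weight w m < Finsupp.weight w d) :
    (pClassComponent p (exponentClass p m) v).weightedOrder w = Finsupp.weight w m := by
  refine le_antisymm (weightedOrder_le w (by rwa [coeff_pClassComponent_initialMonomial])) ?_
  rw [← weightedOrder_eq_of_initialMonomial w hcm hini]
  exact le_weightedOrder_pClassComponent w p _ v

/-- Every OTHER class component has weighted order `> weight m = W(v)`
(«two classes cannot merge into one monomial»). -/
theorem weight_lt_weightedOrder_pClassComponent_of_initialMonomial (p : ℕ) {κ : σ → ZMod p}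
    (hκ : exponentClass p m ≠ κ)
    (hini : ∀ d, coeff d v ≠ 0 → d ≠ m → Finsupp.weight w m < Finsupp.weight w d) :
    (Finsupp.weight w m : ℕ∞) < (pClassComponent p κ v).weightedOrder w := by
  have h : ((Finsupp.weight w m + 1 : ℕ) : ℕ∞) ≤ (pClassComponent p κ v).weightedOrder w := by
    refine nat_le_weightedOrder w fun d hd => ?_
    by_cases hcl : exponentClass p d = κ
    · rw [coeff_pClassComponent_of_eq hcl]
      by_cases hdm : d = m
      · exact absurd (hdm ▸ hcl) hκ
      · exact coeff_eq_zero_of_initialMonomial w hini (Nat.lt_succ_iff.mp hd) hdm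
    · exact coeff_pClassComponent_of_ne hcl v
  exact lt_of_lt_of_le (by exact_mod_cast Nat.lt_succ_self _) h

/-- Removing the INITIAL class component raises the weighted order above `weight m = W(v)`. -/
theorem weight_lt_weightedOrder_sub_pClassComponent_of_initialMonomial (p : ℕ)
    (hini : ∀ d, coeff d v ≠ 0 → d ≠ m → Finsupp.weight w m < Finsupp.weight w d) :
    (Finsupp.weight w m : ℕ∞) <
      (v - pClassComponent p (exponentClass p m) v).weightedOrder w := by
  have h : ((Finsupp.weight w m + 1 : ℕ) : ℕ∞) ≤
      (v - pClassComponent p (exponentClass p m) v).weightedOrder w := by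
    refine nat_le_weightedOrder w fun d hd => ?_
    by_cases hcl : exponentClass p d = exponentClass p m
    · exact coeff_sub_pClassComponent_of_eq hcl v
    · rw [coeff_sub_pClassComponent_of_ne hcl]
      exact coeff_eq_zero_of_initialMonomial w hini (Nat.lt_succ_iff.mp hd) fun h => hcl (h ▸ rfl)
  exact lt_of_lt_of_le (by exact_mod_cast Nat.lt_succ_self _) h

/-- Removing ANOTHER class component keeps the weighted order `weight m = W(v)`. -/
theorem weightedOrder_sub_pClassComponent_of_initialMonomial (p : ℕ) {κ : σ → ZMod p}
    (hκ : exponentClass p m ≠ κ) (hcm : coeff m v ≠ 0)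
    (hini : ∀ d, coeff d v ≠ 0 → d ≠ m → Finsupp.weight w m < Finsupp.weight w d) :
    (v - pClassComponent p κ v).weightedOrder w = Finsupp.weight w m := by
  refine le_antisymm (weightedOrder_le w ?_) ?_
  · rwa [coeff_sub_pClassComponent_of_ne hκ]
  · rw [← weightedOrder_eq_of_initialMonomial w hcm hini]
    exact le_weightedOrder_sub_pClassComponent w p κ v

/-- THE (α)/(β) DICHOTOMY of the Frobenius-class argument, for `G := v_0` (class `0`) and
`R := v - v_0`: if the initial form of `v` is the single monomial `X^m`, then EITHER
(α) `m` has a coordinate not divisible by `p`, `W(R) = W(v) = weight m < W(G)`, OR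
(β) all coordinates of `m` are divisible by `p`, `W(G) = W(v) = weight m < W(R)`. -/
theorem initialMonomial_dichotomy (p : ℕ) (hcm : coeff m v ≠ 0)
    (hini : ∀ d, coeff d v ≠ 0 → d ≠ m → Finsupp.weight w m < Finsupp.weight w d) :
    (exponentClass p m ≠ 0 ∧
        (v - pClassComponent p 0 v).weightedOrder w = Finsupp.weight w m ∧
        (Finsupp.weight w m : ℕ∞) < (pClassComponent p 0 v).weightedOrder w) ∨
      (exponentClass p m = 0 ∧
        (pClassComponent p 0 v).weightedOrder w = Finsupp.weight w m ∧
        (Finsupp.weight w m : ℕ∞) < (v - pClassComponent p 0 v).weightedOrder w) := by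
  by_cases h : exponentClass p m = 0
  · refine Or.inr ⟨h, ?_, ?_⟩
    · rw [← h]
      exact weightedOrder_pClassComponent_of_initialMonomial w p hcm hini
    · rw [← h]
      exact weight_lt_weightedOrder_sub_pClassComponent_of_initialMonomial w p hini
  · exact Or.inl ⟨h, weightedOrder_sub_pClassComponent_of_initialMonomial w p h hcm hini,
      weight_lt_weightedOrder_pClassComponent_of_initialMonomial w p h hini⟩

end InitialMonomial

/-! ## Case (β): the class-`0` part lies in `(X_i^p) ⊆ (X_i)^p` -/

/-- In case (β) (and always): for `v` without constant term, `v ≡ v - v_0` modulo the ideal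
`(X_i^p : i)`, i.e. `v - (v - v_0) = v_0 ∈ (X_i^p : i)` (finitely many variables). -/
theorem sub_sub_pClassComponent_zero_mem_span_X_pow [Fintype σ] [DecidableEq σ] (p : ℕ)
    {v : MvPowerSeries σ K} (h0 : constantCoeff v = 0) :
    v - (v - pClassComponent p 0 v) ∈
      Ideal.span (Set.range fun i : σ => (X i : MvPowerSeries σ K) ^ p) := by
  rw [sub_sub_cancel]
  exact pClassComponent_zero_mem_span_X_pow p h0

/-- The same modulo the `p`-th power of the ideal of the variables. -/
theorem sub_sub_pClassComponent_zero_mem_span_X_pow' [Fintype σ] [DecidableEq σ] (p : ℕ)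
    {v : MvPowerSeries σ K} (h0 : constantCoeff v = 0) :
    v - (v - pClassComponent p 0 v) ∈
      (Ideal.span (Set.range fun i : σ => (X i : MvPowerSeries σ K))) ^ p :=
  span_X_pow_le_span_X_pow p (sub_sub_pClassComponent_zero_mem_span_X_pow p h0)

end Summit.ResolutionOfSingularities.ResolutionOfSingularities.Theorems.LocalEngine.Iota3.PClass
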